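import Literature.NumberTheory.ComplexMultiplication.WeilTorusToSerreGroupPrimeInvariants
import HarnessLib

/-!
# Milne 1999 §5 LEMMA 5.1 and REMARK 5.2: `X^*(S^K) → W^K(p^∞) → {f : Y → ℤ | f + ιf ∈ [K_{w₀} : ℚ_p]ℤ}` are surjective;
# `α^K : P^K → S^K` is injective; `[π] ↦ f_π : X^*(P^K) ≅ {f | f + ιf ∈ [K_{w₀} : ℚ_p]ℤ}`
# (J. S. Milne, *Lefschetz motives and the Tate conjecture*, Compositio Math. 117 (1999), §5 p. 63 Lemma 5.1, Remark 5.2)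

Family `hodge`, lane `lit-hodgefound` (Layer A3; seat `lit-hodgefound-p27`, generation 16, row g16-#3); topic
`Literature/NumberTheory/ComplexMultiplication`, namespace `Literature.NumberTheory.ComplexMultiplication.CMNumbers`.  EIGHTH FILE of
the seat's Milne-1999 series; sequel of g16-#1 `WeilNumberPrimeInvariants` (`f_π = fInv`, `W^K(pⁿ) = weilGroupIn`, `fInvHom`,
`toWeilGroup`, `weilTransitionIn`, the injectivity `weilGerm_toWeilGroup_eq_iff_fInvHom_eq`), g16-#2
`WeilTorusToSerreGroupPrimeInvariants` ((5.1): `fInvHom_alphaUnitIn`, `alphaUnitIn`, `embOfAut`/`autEquivEmb`, `basePrime`,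
`weilGerm_toWeilGroup_alphaUnitIn`) and g15-#3/#5 (`WeilLimit p = W(p^∞)`, `weilGerm`, `weilLimRep`, `weilTorusPoints p R = P(R)`,
`alphaCharOfPrime = (g ↦ π(g))`, `alphaPointsOfPrime = α^K on P(R)`).  Small carriers with bodies (the combinatorial
`FibreSum.pairRep`/`fibre`/`liftFun`; `weilLimitIn = W^K(p^∞)`, `admissibleFuns`, `fInvLim`/`fInvLimEquiv`, `weilLimitInRep`,
`weilTorusInPoints = P^K(R)`, `weilTorusToIn`, `alphaCharIn`, `alphaPointsIn`) + THEOREMS; no named fact (D-0026, net debt 0).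

THE PRINT.  [Milne1999] §5 p. 63 L10–L23 (held `paper:doi-10-1023-a-1000776613765` p0019), verbatim: «LEMMA 5.1. The maps
`X^*(S^K) —(g ↦ [g(ϖ)])→ W^K(p^∞) —([π] ↦ f_π)→ {f : Y → ℤ | f + ιf ∈ [K_{w₀} : ℚ_p]ℤ}` are surjective.  Proof. We know
(Section 4) that the second map is injective, and so it suffices to prove that the composite map is surjective. But it sends
`g ∈ X^*(S^K)` to the map `f : Y → ℤ` such that `f(w) = Σ_{τw = w₀} g(τ)`. Choose a section `s` to the map
`τ ↦ τw₀ : Gal(K/ℚ) → Y` such that `s(ιw) = ιs(w)`, and define `g` so that `g(τ)` is `f(τw₀)` or `0` according as `τ` is in the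
image of `s` or not. Then `g ↦ f`.  Remark 5.2. (a) The lemma shows that the homomorphism `α^K : P^K → S^K` is injective. On
passing to the limit over all `K`, we obtain an injective homomorphism `α : P → S`.  (b) The lemma shows that
`[π] ↦ f_π : X^*(P^K) → {f : Y → ℤ | f + ιf ∈ [K_{w₀} : ℚ_p]ℤ}` is an isomorphism.  (c) The homomorphism `α^K : P^K → S^K` sends
`p^K` to `s^K`.»  (Setting, p. 62 L31–L32: «Fix a CM-subfield `K` of `ℚ^{al}` of finite degree and Galois over `ℚ` and a prime `w₀`
of `K` lying over `p`»; p. 61 L19–L21: «set `W^K(p^∞) = lim→ W^K(pⁿ)`. It is a `Γ`-submodule of `W(p^∞)`, and we define `P^K` to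
be the corresponding quotient of `P`.»)

THE PRINTED PROOF AND THE PROOF HERE.  Write `d = [K_{w₀} : ℚ_p]` (the same for every `w | p`, `K` being Galois) and
`fib(w) = {σ ∈ Gal(K/ℚ) | σw₀ = w}` (a coset of the decomposition group, `|fib(w)| = d`).  The composite map is
`g ↦ (w ↦ Σ_{σ ∈ fib(w)} g(τ₀σ))` by (5.1) (g16-#2 `fInvHom_alphaUnitIn`), and one needs, for `f` with `f(w) + f(ιw) = m·d`,
a `g` with (i) `g(σ) + g(ισ)` CONSTANT (so that `g ∈ X^*(S^K)`) and (ii) `Σ_{fib(w)} g = f(w)`.  The printed recipe does not do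
this in general: a section `s` with `s(ιw) = ιs(w)` does not exist as soon as `ι` fixes some `w ∈ Y` (e.g. `K = ℚ(i)`, `p` inert:
`Y = {w}`, `ιw = w`, but `ιs(w) ≠ s(w)`), and when it exists the printed `g` has `g + ιg = m·d` on `im(s) ∪ ι im(s)` and `= 0`
elsewhere, which is constant only if `im(s) = Gal(K/ℚ)` (`p` totally split) or `m = 0`.  The statement is proved here AS PRINTED
with the following `g` (`FibreSum.liftFun`), constant `g + ιg = m`: choose representatives of the pairs `{σ, ισ} ⊂ Gal(K/ℚ)` and
`{w, ιw} ⊂ Y` (`pairRep`) and a section `s` of `σ ↦ σw₀`; for `σ ∈ fib(w)` put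
`g(σ) = m·[σ is the representative of {σ, ισ}]` if `ιw = w`; `g(σ) = f(w)·[σ = s(w)]` if `ιw ≠ w` and `w` represents `{w, ιw}`;
`g(σ) = m − f(ιw)·[ισ = s(ιw)]` otherwise.  Then (i) holds by construction and (ii) holds because an `ι`-stable fibre consists of
`d/2` pairs and `2f(w) = m·d` there, while for a free pair the two fibres contribute `f(w)` and `m·d − f(ιw) = f(w)`.

DICTIONARY.  As in g16-#1/#2: `K` a CM number field, here GALOIS over `ℚ` (`[IsGalois ℚ K]`); `τ₀ : K →ₐ[ℚ] ℚ^{cm}` the fixed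
embedding; `Y = primesOverSet p K`, `w₀ = basePrime p 𝔭`; `ι` acting on `Y` and on `Gal(K/ℚ)` is the tree's `conjGal : K ≃ₐ[ℚ] K`
(`EmbeddingActionFaithful`; `= IsCMField.complexConj K`, `conjGal_smul_primesOver`), acting on `Hom(K, ℚ^{cm})` through
`ι_{cm} ∘ (τ₀σ) = τ₀ ∘ (ισ)` (`cmNumbersConj_smul_embOfAut`); `d = [K_{w₀} : ℚ_p] = localDegree 𝔭 = |fib(w₀)|`
(`card_fibre_basePrime`, Mathlib's `ncard_primesOver_mul_ramificationIdxIn_mul_inertiaDegIn`); «`{f : Y → ℤ | f + ιf ∈ [K_{w₀} : ℚ_p]ℤ}`»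
= `admissibleFuns K p 𝔭` (`f(w) + f(ιw) = m·d` for one `m ∈ ℤ` and all `w` — «an integer independent of `w` … divisible by
`[K_w : ℚ_p]`», p. 61); `W^K(p^∞) = weilLimitIn K p τ₀ ≤ WeilLimit p` (the germs `[τ₀π]`, `π ∈ W^K(pⁿ)`, `n ≥ 1`; independent of
`τ₀`, `weilLimitIn_eq`); `X^*(P^K) = W^K(p^∞)` with its `Γ`-action `weilLimitInRep`, `P^K(R) = weilTorusInPoints p τ₀ R` (Q768's
`torusPoints`), the quotient map `P → P^K` on points `weilTorusToIn`, `X^*(α^K) = alphaCharIn` (g15-#5's `alphaCharOfPrime` with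
target `W^K(p^∞)`), `α^K : P^K(R) → S^K(R) = alphaPointsIn` with `alphaPointsIn ∘ weilTorusToIn = alphaPointsOfPrime`.

WHAT IS HERE (all PROVED):
* §1 `FibreSum` (a finite group `G` acting on `Y`, `ι ∈ G`, `ι² = 1`, `w₀ ∈ Y`): DEF `pairSetoid`/`pairRep` (`pairRep_spec`,
  `pairRep_smul`), DEF `fibre G w₀ w`, `mem_fibre`, `card_fibre_eq`, `sum_card_fibre`, `card_fibre_mul_card` (`d·|Y| = |G|` for a transitive
  action), `two_mul_card_filter_pairRep` (an `ι`-stable fibre has `d/2` representatives, `ι ≠ 1`), DEF **`liftFun`** (the `g` above),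
  **`liftFun_add_liftFun_mul`** (`g(σ) + g(ισ) = m`), **`sum_fibre_liftFun`** (`Σ_{fib(w)} g = f(w)`), **`exists_fun_sum_fibre_eq`**.
* §2 `cmNumbersConj_smul_embOfAut`, `conjGal_smul_primesOver`, `conjGal_ne_one`, `isPretransitive_algEquiv_primesOverSet` (`Gal(K/ℚ)` is
  transitive on `Y`), `fibre_eq_filter`, **`card_fibre_basePrime : |fib(w₀)| = [K_{w₀} : ℚ_p]`**.
* §3 **LEMMA 5.1 (composite map)** **`exists_infinityTypes_sum_fibre_eq`**: every `f : Y → ℤ` with `f(w) + f(ιw) = m·[K_{w₀} : ℚ_p]` is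
  `w ↦ Σ_{σw₀ = w} g(τ₀σ)` for some `g ∈ X^*(S^K)` (membership by skel-3's `mem_infinityTypes_iff_of_comm`).
* §4 `exists_fInvHom_alphaUnitIn_eq` (`f = f_{g(ϖ)}`), `exists_fInvHom_add_fInvHom_conjGal_smul` (every `f_π`, `π ∈ W^K(pⁿ)`, is admissible),
  **`exists_alphaCharOfPrime_eq_weilGerm`** (every `[π]`, `π ∈ W^K(pⁿ)`, is `π(g)`), DEF **`weilLimitIn K p τ₀ = W^K(p^∞)`** (`mem_weilLimitIn_iff`,
  `weilGerm_toWeilGroup_mem_weilLimitIn`, `toMul_alphaCharOfPrime_mem_weilLimitIn`), **LEMMA 5.1 (first map)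
  `mem_weilLimitIn_iff_exists_alphaCharOfPrime_eq` / `range_alphaCharOfPrime_eq`** (`π(X^*(S^K)) = W^K(p^∞)`), **`smul_mem_weilLimitIn`**
  («a `Γ`-submodule of `W(p^∞)`»), `weilLimitIn_eq` (independence of `τ₀`), `fInvHom_eq_of_weilGerm_eq`, DEF **`admissibleFuns K p 𝔭`**,
  DEF **`fInvLim : W^K(p^∞) →* (Y → ℤ)`, `[π] ↦ f_π`** (`fInvLimFun_mk`, `fInvLim_mk`), **`fInvLim_injective`**, `toAdd_fInvLim_mem_admissibleFuns`,
  **`exists_fInvLim_eq`** (LEMMA 5.1, second map), DEF **`fInvLimEquiv : W^K(p^∞) ≃* {admissible f}`** = **REMARK 5.2 (b)** (`coe_toAdd_fInvLimEquiv`).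
* §5 **REMARK 5.2 (a)**: DEF `weilLimitInAct`/`weilLimitInRep` (`X^*(P^K)` as a `Γ`-module), DEF `weilLimitInSubtype` (+ equivariance),
  DEF **`weilTorusInPoints p τ₀ R = P^K(R)`**, DEF **`weilTorusToIn : P(R) → P^K(R)`**, DEF **`alphaCharIn = X^*(α^K) : X^*(S^K) → W^K(p^∞)`**
  (`coe_toMul_alphaCharIn`, `weilLimitInSubtype_alphaCharIn`, `alphaCharIn_infinityTypesRep`), **`alphaCharIn_surjective`**, DEF **`alphaPointsIn :
  P^K(R) → S^K(R)`**, **`alphaPointsIn_comp_weilTorusToIn`** (`= alphaPointsOfPrime`, g15-#5), **`alphaPointsIn_injective`** («`α^K : P^K → S^K`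
  is injective», on `R`-points for every commutative `ℚ`-algebra `R`).

NOT here: the passage to the limit over all `K` («an injective homomorphism `α : P → S`»), Remark 5.2 (c) (= g15-#5
`eval_constChar_alphaPointsOfPrime`), Prop. 5.3 / Thm. 5.4 (Shimura–Taniyama; Layer B, B5-09).

## References

* [Milne1999] J. S. Milne, *Lefschetz motives and the Tate conjecture*, Compositio Math. 117 (1999) 45–76 — §5 Lemma 5.1,
  Remark 5.2, p. 63 L10–L23; §4 p. 61 L19–L27 (held `paper:doi-10-1023-a-1000776613765` p0017, p0019).
* [NeukirchANT1999] J. Neukirch, *Algebraic Number Theory*, Springer 1999 — Ch. I §9 (decomposition group; `|G_𝔓| = e f` for Galois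
  extensions), Ch. II §8 p. 155.
* [Milne2017] J. S. Milne, *Algebraic Groups*, CUP 2017 — Ch. 12 Thm. 12.9, Rem. 12.26 (points of groups of multiplicative type;
  Q768 `CharacterModuleTorusPoints`).

Provenance: lane `lit-hodgefound`, seat `lit-hodgefound-p27` gen 16 (agent `literature-prover-lit-hodgefound-p27-g16-0`),
row g16-#3 (INBOX 2026-08-23 l.6055).
-/

set_option autoImplicit false

noncomputable section

open scoped NumberField Pointwise ComplexConjugate TensorProduct

namespace Literature.NumberTheory.ComplexMultiplication

namespace CMNumbers

open _root_.NumberField IsDedekindDomain Finset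
open Literature.NumberTheory.NumberFields (cmNumbers cmNumbersConj coe_cmNumbersConj cmNumbersConj_mul_self cmNumbersConj_comm)
open Literature.RingTheory.GaloisAlgebras.CharacterModuleTorus (torusPoints galUnits)
open SerreGroupTorus (infinityTypesRep serrePoints)

/-! ### §1 Pairs `{a, ιa}` and their representatives -/

namespace FibreSum

section PairRep

variable {G : Type*} [Group G]

/-- The equivalence relation on a `G`-set `X` identifying `a` with `ι•a` (`ι² = 1`): its classes are the pairs `{a, ιa}`.
[cite: Milne1999, §5 p. 63 L13–L14 («a section s … such that s(ιw) = ιs(w)»)] -/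
def pairSetoid (ι : G) (hι : ι * ι = 1) (X : Type*) [MulAction G X] : Setoid X where
  r a b := b = a ∨ b = ι • a
  iseqv := by
    refine ⟨fun a => Or.inl rfl, ?_, ?_⟩
    · rintro a b (rfl | rfl)
      · exact Or.inl rfl
      · exact Or.inr (by rw [smul_smul, hι, one_smul])
    · rintro a b c (rfl | rfl) (rfl | rfl)
      · exact Or.inl rfl
      · exact Or.inr rfl
      · exact Or.inr rfl
      · exact Or.inl (by rw [smul_smul, hι, one_smul])

/-- **A representative of the pair `{a, ιa}`** (a choice, the same for `a` and `ιa`). [cite: Milne1999, §5 p. 63 L13–L14] -/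
def pairRep (ι : G) (hι : ι * ι = 1) {X : Type*} [MulAction G X] (a : X) : X :=
  (Quotient.mk (pairSetoid ι hι X) a).out

/-- The representative of `{a, ιa}` is `a` or `ιa`. [cite: Milne1999, §5 p. 63 L13–L14] -/
theorem pairRep_spec (ι : G) (hι : ι * ι = 1) {X : Type*} [MulAction G X] (a : X) :
    pairRep ι hι a = a ∨ pairRep ι hι a = ι • a := by
  have h : (pairSetoid ι hι X).r (pairRep ι hι a) a := Quotient.exact (Quotient.out_eq _)
  rcases h with h | h
  · exact Or.inl h.symm
  · refine Or.inr ?_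
    conv_rhs => rw [h]
    rw [smul_smul, hι, one_smul]

/-- `a` and `ιa` have the same representative. [cite: Milne1999, §5 p. 63 L13–L14] -/
theorem pairRep_smul (ι : G) (hι : ι * ι = 1) {X : Type*} [MulAction G X] (a : X) :
    pairRep ι hι (ι • a) = pairRep ι hι a := by
  unfold pairRep
  congr 1
  exact Quotient.sound (Or.inr (by rw [smul_smul, hι, one_smul]) : (pairSetoid ι hι X).r (ι • a) a)

end PairRep

section Fibre

variable (G : Type*) [Group G] [Fintype G] {Y : Type*} [MulAction G Y] [DecidableEq Y] (w₀ : Y)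

/-- **`fib(w) = {σ ∈ G | σw₀ = w}`**, the fibre of `σ ↦ σw₀ : G → Y` over `w` («the map `τ ↦ τw₀ : Gal(K/ℚ) → Y`»).
[cite: Milne1999, §5 p. 63 L12–L13] -/
def fibre (w : Y) : Finset G := univ.filter fun σ : G => σ • w₀ = w

variable {G}

/-- [cite: Milne1999, §5 p. 63 L12–L13] -/
theorem mem_fibre {w : Y} {σ : G} : σ ∈ fibre G w₀ w ↔ σ • w₀ = w := by simp [fibre]

/-- All fibres over points of the orbit of `w₀` have the same size (`fib(sw₀) = s·fib(w₀)`). [cite: Milne1999, §5 p. 63 L12–L13] -/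
theorem card_fibre_eq {w : Y} {s : G} (hs : s • w₀ = w) : (fibre G w₀ w).card = (fibre G w₀ w₀).card := by
  refine Finset.card_bij' (fun σ _ => s⁻¹ * σ) (fun σ _ => s * σ) ?_ ?_ ?_ ?_
  · intro σ hσ
    rw [mem_fibre] at hσ ⊢
    rw [mul_smul, hσ, ← hs, inv_smul_smul]
  · intro σ hσ
    rw [mem_fibre] at hσ ⊢
    rw [mul_smul, hσ, hs]
  · intro σ _; simp
  · intro σ _; simp

/-- The fibres partition `G`: `Σ_w |fib(w)| = |G|`. [cite: Milne1999, §5 p. 63 L12–L13] -/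
theorem sum_card_fibre [Fintype Y] : ∑ w : Y, (fibre G w₀ w).card = Fintype.card G := by
  rw [← Finset.card_univ, Finset.card_eq_sum_card_fiberwise (f := fun σ : G => σ • w₀) (t := Finset.univ)
    (fun _ _ => mem_univ _)]
  rfl

/-- For a transitive action `|fib(w₀)|·|Y| = |G|` (orbit–stabiliser). [cite: Milne1999, §5 p. 63 L12–L13] -/
theorem card_fibre_mul_card [Fintype Y] [MulAction.IsPretransitive G Y] :
    (fibre G w₀ w₀).card * Fintype.card Y = Fintype.card G := by
  rw [← sum_card_fibre (G := G) w₀, eq_comm]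
  calc ∑ w : Y, (fibre G w₀ w).card = ∑ _w : Y, (fibre G w₀ w₀).card :=
        Finset.sum_congr rfl fun w _ => by
          obtain ⟨s, hs⟩ := MulAction.exists_smul_eq G w₀ w
          exact card_fibre_eq w₀ hs
    _ = (fibre G w₀ w₀).card * Fintype.card Y := by rw [sum_const, card_univ, smul_eq_mul, mul_comm]

variable (ι : G) (hι : ι * ι = 1)

open scoped Classical in
/-- An `ι`-STABLE fibre (`ιw = w`) is a union of pairs `{σ, ισ}` (`ι ≠ 1`): exactly half of its elements are representatives.
[cite: Milne1999, §5 p. 63 L12–L14] -/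
theorem two_mul_card_filter_pairRep (hι1 : ι ≠ 1) {w : Y} (hw : ι • w = w) :
    2 * ((fibre G w₀ w).filter fun σ => pairRep ι hι σ = σ).card = (fibre G w₀ w).card := by
  have hne : ∀ σ : G, ι * σ ≠ σ := fun σ h => hι1 (by simpa using h)
  have hsplit := Finset.card_filter_add_card_filter_not (s := fibre G w₀ w) (fun σ => pairRep ι hι σ = σ)
  have hbij : ((fibre G w₀ w).filter fun σ => ¬pairRep ι hι σ = σ).card =
      ((fibre G w₀ w).filter fun σ => pairRep ι hι σ = σ).card := by
    refine Finset.card_bij' (fun σ _ => ι * σ) (fun σ _ => ι * σ) ?_ ?_ ?_ ?_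
    · intro σ hσ
      rw [mem_filter, mem_fibre] at hσ ⊢
      refine ⟨by rw [mul_smul, hσ.1, hw], ?_⟩
      have h := pairRep_smul ι hι (X := G) σ
      rw [smul_eq_mul] at h
      rw [h]
      rcases pairRep_spec ι hι (X := G) σ with h1 | h1
      · exact absurd h1 hσ.2
      · rw [h1, smul_eq_mul]
    · intro σ hσ
      rw [mem_filter, mem_fibre] at hσ ⊢
      refine ⟨by rw [mul_smul, hσ.1, hw], ?_⟩
      have h := pairRep_smul ι hι (X := G) σ
      rw [smul_eq_mul] at h
      rw [h, hσ.2]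
      exact (hne σ).symm
    · intro σ _; simp [← mul_assoc, hι]
    · intro σ _; simp [← mul_assoc, hι]
  omega

variable (f : Y → ℤ) (m : ℤ)

open scoped Classical in
/-- **The function `g : G → ℤ` with `g(σ) + g(ισ) = m` and `Σ_{fib(w)} g = f(w)`** (replacing the printed «`g(τ)` is `f(τw₀)` or `0`
according as `τ` is in the image of `s` or not», see the module docstring): for `σ` with `w = σw₀`,
`g(σ) = m·[σ = rep σ]` if `ιw = w`; `= f(w)·[σ = s(w)]` if `ιw ≠ w = rep w`; `= m − f(ιw)·[ισ = s(ιw)]` otherwise.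
[cite: Milne1999, §5 p. 63 L13–L15] -/
def liftFun (sY : Y → G) : G → ℤ := fun σ =>
  if ι • σ • w₀ = σ • w₀ then (if pairRep ι hι σ = σ then m else 0)
  else if pairRep ι hι (σ • w₀) = σ • w₀ then (if σ = sY (σ • w₀) then f (σ • w₀) else 0)
  else m - (if ι * σ = sY (ι • σ • w₀) then f (ι • σ • w₀) else 0)

omit [Fintype G] in
open scoped Classical in
/-- **(i) `g(σ) + g(ισ) = m` for every `σ`** (`ι ≠ 1`, `ι² = 1`). [cite: Milne1999, §5 p. 63 L13–L15] -/
theorem liftFun_add_liftFun_mul (hι1 : ι ≠ 1) (sY : Y → G) (σ : G) :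
    liftFun w₀ ι hι f m sY σ + liftFun w₀ ι hι f m sY (ι * σ) = m := by
  have hne : ι * σ ≠ σ := fun h => hι1 (by simpa using h)
  have hιι : ι • ι • σ • w₀ = σ • w₀ := by rw [smul_smul, hι, one_smul]
  unfold liftFun
  simp only [mul_smul]
  by_cases hA : ι • σ • w₀ = σ • w₀
  · rw [if_pos hA, hA, if_pos hA]
    have hrep := pairRep_smul ι hι (X := G) σ
    rw [smul_eq_mul] at hrep
    rw [hrep]
    rcases pairRep_spec ι hι (X := G) σ with h1 | h1
    · rw [if_pos h1, if_neg (show ¬pairRep ι hι σ = ι * σ by rw [h1]; exact hne.symm)]; ring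
    · rw [smul_eq_mul] at h1
      rw [if_neg (show ¬pairRep ι hι σ = σ by rw [h1]; exact hne), if_pos h1]; ring
  · rw [if_neg hA]
    have hA' : ¬ι • ι • σ • w₀ = ι • σ • w₀ := by rw [hιι]; exact fun h => hA h.symm
    rw [if_neg hA', hιι, pairRep_smul]
    by_cases hB : pairRep ι hι (σ • w₀) = σ • w₀
    · rw [if_pos hB, if_neg (show ¬pairRep ι hι (σ • w₀) = ι • σ • w₀ by rw [hB]; exact fun h => hA h.symm)]
      simp only [← mul_assoc, hι, one_mul]
      ring
    · have hC : pairRep ι hι (σ • w₀) = ι • σ • w₀ := (pairRep_spec ι hι (σ • w₀)).resolve_left hB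
      rw [if_neg hB, if_pos hC]
      ring

open scoped Classical in
/-- **(ii) `Σ_{σ ∈ fib(w)} g(σ) = f(w)` for every `w`**, given a section `s` of `σ ↦ σw₀` and `f(w) + f(ιw) = m·|fib(w₀)|` for all `w`.
[cite: Milne1999, §5 p. 63 L13–L15 («Then g ↦ f»)] -/
theorem sum_fibre_liftFun (hι1 : ι ≠ 1) (sY : Y → G) (hsY : ∀ w, sY w • w₀ = w)
    (hf : ∀ w, f w + f (ι • w) = m * (fibre G w₀ w₀).card) (w : Y) :
    ∑ σ ∈ fibre G w₀ w, liftFun w₀ ι hι f m sY σ = f w := by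
  have hd : ((fibre G w₀ w).card : ℤ) = (fibre G w₀ w₀).card := by exact_mod_cast card_fibre_eq w₀ (hsY w)
  have hcongr : ∀ (F : G → Y → ℤ), ∑ σ ∈ fibre G w₀ w, F σ (σ • w₀) = ∑ σ ∈ fibre G w₀ w, F σ w := fun F =>
    Finset.sum_congr rfl fun σ hσ => by rw [(mem_fibre w₀).mp hσ]
  unfold liftFun
  rw [hcongr (fun σ v => if ι • v = v then (if pairRep ι hι σ = σ then m else 0)
    else if pairRep ι hι v = v then (if σ = sY v then f v else 0)
    else m - (if ι * σ = sY (ι • v) then f (ι • v) else 0))]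
  by_cases hA : ι • w = w
  · simp only [if_pos hA]
    rw [Finset.sum_ite, sum_const_zero, add_zero, sum_const, nsmul_eq_mul]
    have h2 := two_mul_card_filter_pairRep w₀ ι hι hι1 hA
    have hfw := hf w
    rw [hA, ← hd] at hfw
    have : (2 : ℤ) * ((fibre G w₀ w).filter fun σ => pairRep ι hι σ = σ).card = (fibre G w₀ w).card := by
      exact_mod_cast h2
    rw [← this] at hfw
    linarith
  · simp only [if_neg hA]
    by_cases hB : pairRep ι hι w = w
    · simp only [if_pos hB]
      rw [Finset.sum_ite_eq' (fibre G w₀ w) (sY w) (fun _ => f w), if_pos ((mem_fibre w₀).mpr (hsY w))]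
    · simp only [if_neg hB]
      rw [sum_sub_distrib, sum_const, nsmul_eq_mul, hd]
      have hkey : ∑ σ ∈ fibre G w₀ w, (if ι * σ = sY (ι • w) then f (ι • w) else 0) = f (ι • w) := by
        have heq : ∀ σ : G, (ι * σ = sY (ι • w)) ↔ (σ = ι * sY (ι • w)) := fun σ => by
          constructor
          · intro h; rw [← h, ← mul_assoc, hι, one_mul]
          · intro h; rw [h, ← mul_assoc, hι, one_mul]
        simp_rw [heq]
        rw [Finset.sum_ite_eq' (fibre G w₀ w) (ι * sY (ι • w)) (fun _ => f (ι • w)), if_pos]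
        rw [mem_fibre, mul_smul, hsY, smul_smul, hι, one_smul]
      rw [hkey]
      linarith [hf w]

include hι in
/-- **The combinatorial heart of Lemma 5.1**: for a transitive `G`-set `Y`, `ι ∈ G` with `ι² = 1 ≠ ι`, and `f : Y → ℤ` with
`f(w) + f(ιw) = m·|fib(w₀)|`, there is `g : G → ℤ` with `g(σ) + g(ισ) = m` and `Σ_{fib(w)} g = f(w)`. [cite: Milne1999, §5 p. 63 L13–L15] -/
theorem exists_fun_sum_fibre_eq [Fintype Y] [MulAction.IsPretransitive G Y] (hι1 : ι ≠ 1)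
    (hf : ∀ w, f w + f (ι • w) = m * (fibre G w₀ w₀).card) :
    ∃ g : G → ℤ, (∀ σ, g σ + g (ι * σ) = m) ∧ ∀ w, ∑ σ ∈ fibre G w₀ w, g σ = f w := by
  choose sY hsY using fun w => MulAction.exists_smul_eq G w₀ w
  exact ⟨liftFun w₀ ι hι f m sY, liftFun_add_liftFun_mul w₀ ι hι f m hι1 sY,
    sum_fibre_liftFun w₀ ι hι f m hι1 sY hsY hf⟩

end Fibre

end FibreSum

/-! ### §2 The CM Galois field `K`: `ι`, the fibres of `σ ↦ σw₀`, and `d = [K_{w₀} : ℚ_p]` -/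

section NumberField

variable {K : Type} [Field K] [NumberField K] [IsCMField K]
variable (p : ℕ) [hp : Fact p.Prime] (𝔭 : Ideal (𝓞 K)) [h𝔭 : 𝔭.LiesOver (Ideal.span {(p : ℤ)})] [h𝔭P : 𝔭.IsPrime]

omit hp h𝔭P in
/-- **`ι ∘ (τ₀ ∘ σ) = τ₀ ∘ (ισ)`**: complex conjugation of `ℚ^{cm}` acts on `Hom(K, ℚ^{cm}) = τ₀ ∘ Gal(K/ℚ)` through left
multiplication by `ι = conjGal ∈ Gal(K/ℚ)` (g16-#1 `apply_complexConj`). [cite: Milne1999, §5 p. 62 L32–L33 («g + ιg is constant»)] -/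
theorem cmNumbersConj_smul_embOfAut (τ₀ : K →ₐ[ℚ] cmNumbers) (σ : K ≃ₐ[ℚ] K) :
    cmNumbersConj • embOfAut τ₀ σ = embOfAut τ₀ (conjGal * σ) := by
  ext x
  rw [algEquiv_smul_apply, embOfAut_apply, embOfAut_apply, AlgEquiv.mul_apply, conjGal_apply, apply_complexConj]

omit hp in
/-- The two spellings of `ιw` on `Y` agree: `conjGal • w` (`Gal(K/ℚ)`, Mathlib's `galRestrict` action) and
`IsCMField.complexConj K • w` (`Gal(K/K⁺)`, pointwise; g16-#1 §4). [cite: Milne1999, §4 p. 61 L25–L26] -/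
theorem conjGal_smul_primesOver (w : primesOverSet p K) :
    (conjGal : K ≃ₐ[ℚ] K) • w = IsCMField.complexConj K • w := by
  rw [algEquiv_smul_primesOver_eq]
  apply Subtype.ext
  rw [Ideal.coe_smul_primesOver, Ideal.coe_smul_primesOver, Ideal.pointwise_smul_def, Ideal.pointwise_smul_def]
  rfl

omit hp h𝔭 h𝔭P in
/-- `ι ≠ 1` in `Gal(K/ℚ)`. [cite: MilneCM2006, Ch. I §1 (p. 10)] -/
theorem conjGal_ne_one : (conjGal : K ≃ₐ[ℚ] K) ≠ 1 := by
  intro h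
  apply IsCMField.complexConj_ne_one K
  ext x
  have := AlgEquiv.congr_fun h x
  rw [conjGal_apply] at this
  exact this

omit hp in
/-- **`Gal(K/ℚ)` acts transitively on `Y`** for `K` Galois (Mathlib `exists_smul_eq_of_isGaloisGroup`, in the `galRestrict` spelling).
[cite: NeukirchANT1999, Ch. I §9 (transitivity on the primes over 𝔭)] -/
instance isPretransitive_algEquiv_primesOverSet [IsGalois ℚ K] :
    MulAction.IsPretransitive (K ≃ₐ[ℚ] K) (primesOverSet p K) :=
  ⟨fun w w' => by
    obtain ⟨σ, hσ⟩ := Ideal.exists_smul_eq_of_isGaloisGroup (Ideal.span {(p : ℤ)}) w.1 w'.1 (K ≃ₐ[ℚ] K)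
    exact ⟨σ, Subtype.ext (by rw [coe_algEquiv_smul_primesOver]; exact hσ)⟩⟩

omit [IsCMField K] hp in
/-- The fibres of §1 for `G = Gal(K/ℚ)`, `w₀ = basePrime p 𝔭` are the index sets of the sums in (5.1) (g16-#2). [cite: Milne1999, §5 p. 63 display (5.1)] -/
theorem fibre_eq_filter (w : primesOverSet p K) :
    FibreSum.fibre (K ≃ₐ[ℚ] K) (basePrime p 𝔭) w = Finset.univ.filter fun σ : K ≃ₐ[ℚ] K => σ • basePrime p 𝔭 = w := rfl

omit [IsCMField K] in
/-- **`|fib(w₀)| = e(w₀/p)·f(w₀/p) = [K_{w₀} : ℚ_p]`** for `K` Galois over `ℚ`: `|fib(w₀)|·|Y| = |Gal(K/ℚ)|` (§1) and the fundamental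
identity `|Y|·e·f = |Gal(K/ℚ)|` (Mathlib `ncard_primesOver_mul_ramificationIdxIn_mul_inertiaDegIn`). [cite: NeukirchANT1999, Ch. I §9] [cite: Milne1999, §5 p. 63 L11 («[K_{w₀} : ℚ_p]ℤ»)] -/
theorem card_fibre_basePrime [IsGalois ℚ K] :
    (FibreSum.fibre (K ≃ₐ[ℚ] K) (basePrime p 𝔭) (basePrime p 𝔭)).card = localDegree 𝔭 := by
  haveI := Fintype.ofFinite (primesOverSet p K)
  have h1 := FibreSum.card_fibre_mul_card (G := K ≃ₐ[ℚ] K) (basePrime p 𝔭)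
  haveI : (Ideal.span {(p : ℤ)}).IsPrime := (Ideal.span_singleton_prime (Int.natCast_ne_zero.mpr hp.out.ne_zero)).mpr
    (Nat.prime_iff_prime_int.mp hp.out)
  have h2 := Ideal.ncard_primesOver_mul_ramificationIdxIn_mul_inertiaDegIn (Ideal.span {(p : ℤ)}) (𝓞 K) (K ≃ₐ[ℚ] K)
  rw [Ideal.ramificationIdxIn_eq_ramificationIdx (Ideal.span {(p : ℤ)}) 𝔭 (K ≃ₐ[ℚ] K),
    Ideal.inertiaDegIn_eq_inertiaDeg (Ideal.span {(p : ℤ)}) 𝔭 (K ≃ₐ[ℚ] K), Nat.card_eq_fintype_card,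
    Set.ncard_eq_toFinset_card', Set.toFinset_card] at h2
  rw [← h2, ← localDegree] at h1
  have hY : 0 < Fintype.card (primesOverSet p K) := Fintype.card_pos
  exact Nat.eq_of_mul_eq_mul_right hY (by rw [h1, mul_comm])

/-! ### §3 LEMMA 5.1: the composite `X^*(S^K) → {f : Y → ℤ | f + ιf ∈ [K_w : ℚ_p]ℤ}` is surjective -/

variable (τ₀ : K →ₐ[ℚ] cmNumbers)

/-- **LEMMA 5.1, THE COMPOSITE MAP IS SURJECTIVE: every `f : Y → ℤ` with `f(w) + f(ιw) = m·[K_{w₀} : ℚ_p]` for all `w | p` is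
`w ↦ Σ_{σw₀ = w} g(τ₀σ)` for some `g ∈ X^*(S^K)`** (`K` CM, Galois over `ℚ`).  The `g` is §1's `liftFun` transported along
`autEquivEmb τ₀ : Gal(K/ℚ) ≃ Hom(K, ℚ^{cm})`; it satisfies `g(τ) + g(ιτ) = m` for all `τ`, hence lies in `X^*(S^K)` (skel-3's
`mem_infinityTypes_iff_of_comm`, `ι` central in `Γ`). [cite: Milne1999, §5 p. 63 Lemma 5.1 (L10–L15)] -/
theorem exists_infinityTypes_sum_fibre_eq [IsGalois ℚ K] (f : primesOverSet p K → ℤ) (m : ℤ)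
    (hf : ∀ w, f w + f ((conjGal : K ≃ₐ[ℚ] K) • w) = m * localDegree 𝔭) :
    ∃ g ∈ infinityTypes (cmNumbers ≃ₐ[ℚ] cmNumbers) (K →ₐ[ℚ] cmNumbers) cmNumbersConj,
      ∀ w : primesOverSet p K,
        ∑ σ ∈ Finset.univ.filter (fun σ : K ≃ₐ[ℚ] K => σ • basePrime p 𝔭 = w), g (embOfAut τ₀ σ) = f w := by
  haveI := Fintype.ofFinite (primesOverSet p K)
  have hf' : ∀ w, f w + f ((conjGal : K ≃ₐ[ℚ] K) • w) =
      m * (FibreSum.fibre (K ≃ₐ[ℚ] K) (basePrime p 𝔭) (basePrime p 𝔭)).card := by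
    intro w; rw [card_fibre_basePrime]; exact hf w
  have key := FibreSum.exists_fun_sum_fibre_eq (G := K ≃ₐ[ℚ] K) (basePrime p 𝔭) conjGal conjGal_mul_conjGal f m
    conjGal_ne_one
  obtain ⟨g₀, hg₀, hsum⟩ := key hf'
  refine ⟨fun τ => g₀ ((autEquivEmb τ₀).symm τ), ?_, fun w => ?_⟩
  · -- membership: `g(x) + g(ιx) = m` for all `x`
    have hall : ∀ x : K →ₐ[ℚ] cmNumbers, g₀ ((autEquivEmb τ₀).symm x) + g₀ ((autEquivEmb τ₀).symm (cmNumbersConj • x)) = m := by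
      intro x
      obtain ⟨σ, rfl⟩ := (autEquivEmb τ₀).surjective x
      rw [autEquivEmb_apply, cmNumbersConj_smul_embOfAut, ← autEquivEmb_apply, ← autEquivEmb_apply, Equiv.symm_apply_apply,
        Equiv.symm_apply_apply]
      exact hg₀ σ
    rw [mem_infinityTypes_iff_of_comm (fun σ x => AlgHom.ext fun y => by
      simp only [algEquiv_smul_apply]; exact cmNumbersConj_comm σ (x y))]
    intro σ x
    have hinv : cmNumbersConj⁻¹ = cmNumbersConj := inv_eq_of_mul_eq_one_right cmNumbersConj_mul_self
    rw [hinv, hall, hall]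
  · rw [← fibre_eq_filter, ← hsum w]
    refine Finset.sum_congr rfl fun σ _ => ?_
    dsimp only
    rw [← autEquivEmb_apply, Equiv.symm_apply_apply]

end NumberField

/-! ### §4 LEMMA 5.1 for the first map, `W^K(p^∞)`, and REMARK 5.2 -/

section Limit

variable {K : Type} [Field K] [NumberField K] [IsCMField K]
variable (p : ℕ) [hp : Fact p.Prime] (𝔭 : Ideal (𝓞 K)) [h𝔭 : 𝔭.LiesOver (Ideal.span {(p : ℤ)})] [h𝔭P : 𝔭.IsPrime]
variable (τ₀ : K →ₐ[ℚ] cmNumbers)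

/-- **Lemma 5.1 in the packaging of g16-#1/#2: every admissible `f` is `f_{g(ϖ)}`** (`fInvHom (alphaUnitIn g) = f`).
[cite: Milne1999, §5 p. 63 Lemma 5.1] -/
theorem exists_fInvHom_alphaUnitIn_eq [IsGalois ℚ K] (f : primesOverSet p K → ℤ) (m : ℤ)
    (hf : ∀ w, f w + f ((conjGal : K ≃ₐ[ℚ] K) • w) = m * localDegree 𝔭) :
    ∃ g : infinityTypes (cmNumbers ≃ₐ[ℚ] cmNumbers) (K →ₐ[ℚ] cmNumbers) cmNumbersConj,
      (fInvHom (alphaUnitIn p 𝔭 τ₀ g)).toAdd = f := by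
  obtain ⟨g, hg, hsum⟩ := exists_infinityTypes_sum_fibre_eq p 𝔭 τ₀ f m hf
  refine ⟨⟨g, hg⟩, funext fun w => ?_⟩
  rw [fInvHom_alphaUnitIn]
  exact hsum w

/-- **The invariants `f_π` of `π ∈ W^K(pⁿ)` (`n ≥ 1`) are admissible**: `f_π(w) + f_π(ιw) = m·[K_{w₀} : ℚ_p]` with `m` the exponent of
`π` (g16-#1 `IsWeilNumberIn.fInv_add_fInv_complexConj_smul`; `[K_w : ℚ_p] = [K_{w₀} : ℚ_p]` for `K` Galois).
[cite: Milne1999, §4 p. 61 L25–L26] -/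
theorem exists_fInvHom_add_fInvHom_conjGal_smul [IsGalois ℚ K] {n : ℕ} (hn : n ≠ 0) (u : weilGroupIn K p n) :
    ∃ m : ℤ, ∀ w : primesOverSet p K,
      (fInvHom u).toAdd w + (fInvHom u).toAdd ((conjGal : K ≃ₐ[ℚ] K) • w) = m * localDegree 𝔭 := by
  obtain ⟨m, hm⟩ := u.2.1
  refine ⟨m, fun w => ?_⟩
  have h := hm.fInv_add_fInv_complexConj_smul hn w
  have hd : localDegree w.1 = localDegree 𝔭 := localDegree_eq_of_isGalois p w (basePrime p 𝔭)
  rw [← conjGal_smul_primesOver, hd, ← fInvHom_apply, ← fInvHom_apply] at h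
  exact_mod_cast h

/-- **LEMMA 5.1, FIRST MAP: every `[τ₀π]`, `π ∈ W^K(pⁿ)`, is `π(g) = [g(ϖ)]` for some `g ∈ X^*(S^K)`** — take `g` with `f_{g(ϖ)} = f_π`
(composite surjectivity) and conclude by the injectivity of `[π] ↦ f_π` (g16-#1), comparing at the common level `p^{fh·n}`
(`weilTransitionIn`). [cite: Milne1999, §5 p. 63 Lemma 5.1 (L10–L12)] -/
theorem exists_alphaCharOfPrime_eq_weilGerm [IsGalois ℚ K] {n : ℕ+} (u : weilGroupIn K p n) :
    ∃ g : infinityTypes (cmNumbers ≃ₐ[ℚ] cmNumbers) (K →ₐ[ℚ] cmNumbers) cmNumbersConj,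
      Additive.toMul (alphaCharOfPrime p 𝔭 g) = weilGerm n (toWeilGroup τ₀ u) := by
  obtain ⟨m, hm⟩ := exists_fInvHom_add_fInvHom_conjGal_smul p 𝔭 n.ne_zero u
  obtain ⟨g, hg⟩ := exists_fInvHom_alphaUnitIn_eq p 𝔭 τ₀ (fun w => (fInvHom u).toAdd w) m hm
  refine ⟨g, ?_⟩
  -- compare at the common level `ℓ n`, `ℓ = f(𝔭/p) h`
  set ℓ : ℕ+ := primeLevel p 𝔭
  have hL : ((ℓ * n : ℕ+) : ℕ) ≠ 0 := PNat.ne_zero _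
  have h1 : (ℓ : ℕ) ∣ ((ℓ * n : ℕ+) : ℕ) := Dvd.intro _ rfl
  have h2 : (n : ℕ) ∣ ((ℓ * n : ℕ+) : ℕ) := Dvd.intro_left _ rfl
  have hf : fInvHom (weilTransitionIn hL h1 (alphaUnitIn p 𝔭 τ₀ g)) = fInvHom (weilTransitionIn hL h2 u) := by
    rw [fInvHom_weilTransitionIn, fInvHom_weilTransitionIn]
    exact congrArg Multiplicative.ofAdd hg
  have hgerm := (weilGerm_toWeilGroup_eq_iff_fInvHom_eq (n := ℓ * n) τ₀ _ _).mpr hf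
  rw [toWeilGroup_weilTransitionIn, toWeilGroup_weilTransitionIn, weilGerm_weilTransition, weilGerm_weilTransition,
    weilGerm_toWeilGroup_alphaUnitIn] at hgerm
  exact hgerm

variable (K) in
/-- **`W^K(p^∞) = lim→ W^K(pⁿ) ⊂ W(p^∞)`**: the subgroup of g15-#3's `WeilLimit p` of the germs `[τ₀π]`, `π ∈ W^K(pⁿ)`, `n ≥ 1` («set
`W^K(p^∞) = lim→ W^K(pⁿ)`. It is a `Γ`-submodule of `W(p^∞)`»; for `K` Galois it does not depend on `τ₀`, `weilLimitIn_eq`).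
[cite: Milne1999, §4 p. 61 L19–L21] -/
def weilLimitIn : Subgroup (WeilLimit p) where
  carrier := {x | ∃ (n : ℕ+) (u : weilGroupIn K p n), weilGerm n (toWeilGroup τ₀ u) = x}
  one_mem' := ⟨1, 1, by rw [map_one, weilGerm_one]⟩
  mul_mem' := by
    rintro x y ⟨n, u, rfl⟩ ⟨n', v, rfl⟩
    refine ⟨n * n', weilTransitionIn (PNat.ne_zero _) (Dvd.intro _ rfl) u *
      weilTransitionIn (PNat.ne_zero _) (Dvd.intro_left _ rfl) v, ?_⟩
    rw [map_mul, ← weilGerm_mul, toWeilGroup_weilTransitionIn, toWeilGroup_weilTransitionIn, weilGerm_weilTransition,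
      weilGerm_weilTransition]
  inv_mem' := by
    rintro x ⟨n, u, rfl⟩
    exact ⟨n, u⁻¹, by rw [map_inv, weilGerm_inv]⟩

omit h𝔭 h𝔭P in
/-- [cite: Milne1999, §4 p. 61 L19–L21] -/
theorem mem_weilLimitIn_iff (x : WeilLimit p) :
    x ∈ weilLimitIn K p τ₀ ↔ ∃ (n : ℕ+) (u : weilGroupIn K p n), weilGerm n (toWeilGroup τ₀ u) = x := Iff.rfl

omit h𝔭 h𝔭P in
/-- `[τ₀π] ∈ W^K(p^∞)` for `π ∈ W^K(pⁿ)`. [cite: Milne1999, §4 p. 61 L19–L21] -/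
theorem weilGerm_toWeilGroup_mem_weilLimitIn {n : ℕ+} (u : weilGroupIn K p n) :
    weilGerm n (toWeilGroup τ₀ u) ∈ weilLimitIn K p τ₀ := ⟨n, u, rfl⟩

/-- `π(g) = [g(ϖ)] ∈ W^K(p^∞)` for `g ∈ X^*(S^K)` (g16-#2 `alphaUnitIn`). [cite: Milne1999, §5 p. 63 L6–L8 («X^*(S^K) → W^K(p^∞)»)] -/
theorem toMul_alphaCharOfPrime_mem_weilLimitIn [Normal ℚ K]
    (g : infinityTypes (cmNumbers ≃ₐ[ℚ] cmNumbers) (K →ₐ[ℚ] cmNumbers) cmNumbersConj) :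
    Additive.toMul (alphaCharOfPrime p 𝔭 g) ∈ weilLimitIn K p τ₀ :=
  ⟨primeLevel p 𝔭, alphaUnitIn p 𝔭 τ₀ g, weilGerm_toWeilGroup_alphaUnitIn p 𝔭 τ₀ g⟩

/-- **LEMMA 5.1, FIRST MAP: `g ↦ [g(ϖ)] : X^*(S^K) → W^K(p^∞)` IS SURJECTIVE** — `W^K(p^∞)` is exactly the image of g15-#5's
`alphaCharOfPrime p 𝔭` (`K` CM, Galois over `ℚ`). [cite: Milne1999, §5 p. 63 Lemma 5.1 (L10–L12)] -/
theorem mem_weilLimitIn_iff_exists_alphaCharOfPrime_eq [IsGalois ℚ K] (x : WeilLimit p) :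
    x ∈ weilLimitIn K p τ₀ ↔
      ∃ g : infinityTypes (cmNumbers ≃ₐ[ℚ] cmNumbers) (K →ₐ[ℚ] cmNumbers) cmNumbersConj,
        Additive.toMul (alphaCharOfPrime p 𝔭 g) = x := by
  constructor
  · rintro ⟨n, u, rfl⟩
    exact exists_alphaCharOfPrime_eq_weilGerm p 𝔭 τ₀ u
  · rintro ⟨g, rfl⟩
    exact toMul_alphaCharOfPrime_mem_weilLimitIn p 𝔭 τ₀ g

/-- The same as an equality of sets: `π(X^*(S^K)) = W^K(p^∞)`. [cite: Milne1999, §5 p. 63 Lemma 5.1 (L10–L12)] -/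
theorem range_alphaCharOfPrime_eq [IsGalois ℚ K] :
    Set.range (fun g : infinityTypes (cmNumbers ≃ₐ[ℚ] cmNumbers) (K →ₐ[ℚ] cmNumbers) cmNumbersConj =>
      Additive.toMul (alphaCharOfPrime p 𝔭 g)) = (weilLimitIn K p τ₀ : Set (WeilLimit p)) := by
  ext x
  rw [Set.mem_range, SetLike.mem_coe, mem_weilLimitIn_iff_exists_alphaCharOfPrime_eq p 𝔭 τ₀ x]

/-- **«It is a `Γ`-submodule of `W(p^∞)`»**: `W^K(p^∞)` is stable under `Γ = Gal(ℚ^{cm}/ℚ)` (`σ·π(g) = π(σg)`,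
g15-#5 `alphaCharOfPrime_infinityTypesRep`, and Lemma 5.1). [cite: Milne1999, §4 p. 61 L20–L21] -/
theorem smul_mem_weilLimitIn [IsGalois ℚ K] (σ : cmNumbers ≃ₐ[ℚ] cmNumbers) {x : WeilLimit p}
    (hx : x ∈ weilLimitIn K p τ₀) : σ • x ∈ weilLimitIn K p τ₀ := by
  -- any prime `w₁ | p` serves as base point
  obtain ⟨w₁⟩ := nonempty_primesOverSet (K := K) p
  haveI := w₁.2.1
  haveI := w₁.2.2
  obtain ⟨g, rfl⟩ := (mem_weilLimitIn_iff_exists_alphaCharOfPrime_eq p w₁.1 τ₀ x).mp hx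
  refine (mem_weilLimitIn_iff_exists_alphaCharOfPrime_eq p w₁.1 τ₀ _).mpr
    ⟨infinityTypesRep (cmNumbers ≃ₐ[ℚ] cmNumbers) (K →ₐ[ℚ] cmNumbers) cmNumbersConj σ g, ?_⟩
  rw [alphaCharOfPrime_infinityTypesRep, weilLimRep_apply, toMul_ofMul, WeilLimit.smul_def]

/-- For `K` Galois `W^K(p^∞) ⊂ W(p^∞)` does not depend on the embedding `τ₀` (it is the image of `alphaCharOfPrime`, which does not
mention `τ₀`). [cite: Milne1999, §4 p. 61 L19–L21] -/
theorem weilLimitIn_eq [IsGalois ℚ K] (τ₁ : K →ₐ[ℚ] cmNumbers) : weilLimitIn K p τ₁ = weilLimitIn K p τ₀ := by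
  obtain ⟨w₁⟩ := nonempty_primesOverSet (K := K) p
  haveI := w₁.2.1
  haveI := w₁.2.2
  ext x
  rw [mem_weilLimitIn_iff_exists_alphaCharOfPrime_eq p w₁.1 τ₁, mem_weilLimitIn_iff_exists_alphaCharOfPrime_eq p w₁.1 τ₀]

/-! #### Remark 5.2 (b): `[π] ↦ f_π : W^K(p^∞) ≅ {f : Y → ℤ | f + ιf ∈ [K_{w₀} : ℚ_p]ℤ}` -/

omit h𝔭 h𝔭P in
/-- **«The number `f_π(w)` depends only on the class `[π]` of `π` in `W^K(p^∞)`»** across levels: `[τ₀π] = [τ₀π′]` forces `f_π = f_{π′}`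
(common level `nn′`, g16-#1 `weilGerm_toWeilGroup_eq_iff_fInvHom_eq`). [cite: Milne1999, §4 p. 61 L21–L22] -/
theorem fInvHom_eq_of_weilGerm_eq {n n' : ℕ+} (u : weilGroupIn K p n) (v : weilGroupIn K p n')
    (h : weilGerm n (toWeilGroup τ₀ u) = weilGerm n' (toWeilGroup τ₀ v)) : fInvHom u = fInvHom v := by
  have hL : ((n * n' : ℕ+) : ℕ) ≠ 0 := PNat.ne_zero _
  have h1 : (n : ℕ) ∣ ((n * n' : ℕ+) : ℕ) := Dvd.intro _ rfl
  have h2 : (n' : ℕ) ∣ ((n * n' : ℕ+) : ℕ) := Dvd.intro_left _ rfl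
  rw [← fInvHom_weilTransitionIn hL h1 u, ← fInvHom_weilTransitionIn hL h2 v,
    ← weilGerm_toWeilGroup_eq_iff_fInvHom_eq (n := n * n') τ₀, toWeilGroup_weilTransitionIn,
    toWeilGroup_weilTransitionIn, weilGerm_weilTransition, weilGerm_weilTransition]
  exact h

variable (K) in
/-- **«`{f : Y → ℤ | f + ιf ∈ [K_{w₀} : ℚ_p]ℤ}`»**: the functions with `f(w) + f(ιw) = m·[K_{w₀} : ℚ_p]` for one integer `m` and all
`w | p` («`f(w) + f(ιw)` is an integer independent of `w ∈ Y` and divisible by `[K_w : ℚ_p]`», p. 61), an additive subgroup.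
[cite: Milne1999, §5 p. 63 L11, §4 p. 61 L25–L26] -/
def admissibleFuns : AddSubgroup (primesOverSet p K → ℤ) where
  carrier := {f | ∃ m : ℤ, ∀ w, f w + f ((conjGal : K ≃ₐ[ℚ] K) • w) = m * localDegree 𝔭}
  zero_mem' := ⟨0, fun w => by simp⟩
  add_mem' := by
    rintro f f' ⟨m, hm⟩ ⟨m', hm'⟩
    exact ⟨m + m', fun w => by rw [Pi.add_apply, Pi.add_apply, add_add_add_comm, hm, hm', add_mul]⟩
  neg_mem' := by
    rintro f ⟨m, hm⟩
    exact ⟨-m, fun w => by rw [Pi.neg_apply, Pi.neg_apply, ← neg_add, hm, neg_mul]⟩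

omit hp h𝔭 h𝔭P in
/-- [cite: Milne1999, §5 p. 63 L11] -/
theorem mem_admissibleFuns_iff (f : primesOverSet p K → ℤ) :
    f ∈ admissibleFuns K p 𝔭 ↔ ∃ m : ℤ, ∀ w, f w + f ((conjGal : K ≃ₐ[ℚ] K) • w) = m * localDegree 𝔭 := Iff.rfl

/-- The value `f_π` at a germ `[τ₀π] ∈ W^K(p^∞)`, through a chosen representative `π` (well defined by
`fInvHom_eq_of_weilGerm_eq`). [cite: Milne1999, §4 p. 61 L21–L24] -/
def fInvLimFun (x : weilLimitIn K p τ₀) : primesOverSet p K → ℤ :=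
  (fInvHom (Classical.choose (Classical.choose_spec x.2))).toAdd

omit h𝔭 h𝔭P in
/-- `fInvLimFun [τ₀π] = f_π`. [cite: Milne1999, §4 p. 61 L21–L24] -/
theorem fInvLimFun_mk {n : ℕ+} (u : weilGroupIn K p n) :
    fInvLimFun p τ₀ ⟨weilGerm n (toWeilGroup τ₀ u), weilGerm_toWeilGroup_mem_weilLimitIn p τ₀ u⟩ = (fInvHom u).toAdd := by
  unfold fInvLimFun
  set x : weilLimitIn K p τ₀ := ⟨weilGerm n (toWeilGroup τ₀ u), weilGerm_toWeilGroup_mem_weilLimitIn p τ₀ u⟩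
  have h := Classical.choose_spec (Classical.choose_spec x.2)
  exact congrArg Multiplicative.toAdd (fInvHom_eq_of_weilGerm_eq p τ₀ _ _ h)

/-- **«`[π] ↦ f_π` is a homomorphism from `W^K(p^∞)` to the set of functions `f : Y → ℤ`»** — now on the LIMIT `W^K(p^∞) = weilLimitIn`
(g16-#1's `fInvHom` at each level, compatible with the transition maps). [cite: Milne1999, §4 p. 61 L21–L24] -/
def fInvLim : weilLimitIn K p τ₀ →* Multiplicative (primesOverSet p K → ℤ) where
  toFun x := Multiplicative.ofAdd (fInvLimFun p τ₀ x)
  map_one' := by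
    have h := fInvLimFun_mk p τ₀ (n := 1) 1
    have h1 : (⟨weilGerm 1 (toWeilGroup τ₀ (1 : weilGroupIn K p ((1 : ℕ+) : ℕ))), weilGerm_toWeilGroup_mem_weilLimitIn p τ₀ _⟩ :
        weilLimitIn K p τ₀) = 1 :=
      Subtype.ext (show weilGerm 1 (toWeilGroup τ₀ (1 : weilGroupIn K p ((1 : ℕ+) : ℕ))) = 1 by rw [map_one, weilGerm_one])
    rw [h1, map_one] at h
    rw [h]; rfl
  map_mul' := by
    rintro ⟨x, hx⟩ ⟨y, hy⟩
    obtain ⟨n, u, hu⟩ := id hx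
    obtain ⟨n', v, hv⟩ := id hy
    subst hu
    subst hv
    have hgerm : weilGerm (n * n') (toWeilGroup τ₀ (weilTransitionIn (PNat.ne_zero _) (Dvd.intro _ rfl) u *
        weilTransitionIn (PNat.ne_zero _) (Dvd.intro_left _ rfl) v)) =
        weilGerm n (toWeilGroup τ₀ u) * weilGerm n' (toWeilGroup τ₀ v) := by
      rw [map_mul, ← weilGerm_mul, toWeilGroup_weilTransitionIn, toWeilGroup_weilTransitionIn, weilGerm_weilTransition,
        weilGerm_weilTransition]
    have hprod : (⟨weilGerm n (toWeilGroup τ₀ u), hx⟩ * ⟨weilGerm n' (toWeilGroup τ₀ v), hy⟩ : weilLimitIn K p τ₀) =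
        ⟨_, weilGerm_toWeilGroup_mem_weilLimitIn p τ₀ (weilTransitionIn (PNat.ne_zero _) (Dvd.intro _ rfl) u *
          weilTransitionIn (PNat.ne_zero _) (Dvd.intro_left _ rfl) v)⟩ :=
      Subtype.ext hgerm.symm
    rw [hprod, fInvLimFun_mk, fInvLimFun_mk, fInvLimFun_mk, map_mul, fInvHom_weilTransitionIn, fInvHom_weilTransitionIn,
      toAdd_mul, ofAdd_add]

omit h𝔭 h𝔭P in
/-- `fInvLim [τ₀π] = f_π` (g16-#1 `fInvHom π`). [cite: Milne1999, §4 p. 61 L21–L24] -/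
theorem fInvLim_mk {n : ℕ+} (u : weilGroupIn K p n) :
    fInvLim p τ₀ ⟨weilGerm n (toWeilGroup τ₀ u), weilGerm_toWeilGroup_mem_weilLimitIn p τ₀ u⟩ = fInvHom u := by
  change Multiplicative.ofAdd (fInvLimFun p τ₀ _) = _
  rw [fInvLimFun_mk]
  rfl

omit h𝔭 h𝔭P in
/-- **«This homomorphism is obviously injective»** — on `W^K(p^∞)` (g16-#1 `weilGerm_toWeilGroup_eq_iff_fInvHom_eq` at a common level).
[cite: Milne1999, §4 p. 61 L24–L25] -/
theorem fInvLim_injective : Function.Injective (fInvLim (K := K) p τ₀) := by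
  rintro ⟨x, hx⟩ ⟨y, hy⟩ h
  obtain ⟨n, u, rfl⟩ := hx
  obtain ⟨n', v, rfl⟩ := hy
  rw [fInvLim_mk, fInvLim_mk] at h
  apply Subtype.ext
  -- common level
  have hL : ((n * n' : ℕ+) : ℕ) ≠ 0 := PNat.ne_zero _
  have h1 : (n : ℕ) ∣ ((n * n' : ℕ+) : ℕ) := Dvd.intro _ rfl
  have h2 : (n' : ℕ) ∣ ((n * n' : ℕ+) : ℕ) := Dvd.intro_left _ rfl
  rw [← fInvHom_weilTransitionIn hL h1 u, ← fInvHom_weilTransitionIn hL h2 v,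
    ← weilGerm_toWeilGroup_eq_iff_fInvHom_eq (n := n * n') τ₀, toWeilGroup_weilTransitionIn,
    toWeilGroup_weilTransitionIn, weilGerm_weilTransition, weilGerm_weilTransition] at h
  exact h

/-- **«the functions in the image have the property that `f(w) + f(ιw)` is an integer independent of `w ∈ Y` and divisible by
`[K_w : ℚ_p]`»**: `fInvLim` lands in `admissibleFuns`. [cite: Milne1999, §4 p. 61 L25–L26] -/
theorem toAdd_fInvLim_mem_admissibleFuns [IsGalois ℚ K] (x : weilLimitIn K p τ₀) :
    (fInvLim p τ₀ x).toAdd ∈ admissibleFuns K p 𝔭 := by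
  obtain ⟨n, u, hu⟩ := x.2
  have hx : x = ⟨weilGerm n (toWeilGroup τ₀ u), weilGerm_toWeilGroup_mem_weilLimitIn p τ₀ u⟩ := Subtype.ext hu.symm
  rw [hx, fInvLim_mk]
  exact exists_fInvHom_add_fInvHom_conjGal_smul p 𝔭 n.ne_zero u

/-- **LEMMA 5.1, SECOND MAP: `[π] ↦ f_π : W^K(p^∞) → {admissible f}` IS SURJECTIVE** (indeed `f = f_{g(ϖ)}`; «Later (5.1) we shall see that
every `f` with this property is in the image»). [cite: Milne1999, §5 p. 63 Lemma 5.1 (L10–L12), §4 p. 61 L26–L27] -/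
theorem exists_fInvLim_eq [IsGalois ℚ K] {f : primesOverSet p K → ℤ} (hf : f ∈ admissibleFuns K p 𝔭) :
    ∃ x : weilLimitIn K p τ₀, (fInvLim p τ₀ x).toAdd = f := by
  obtain ⟨m, hm⟩ := hf
  obtain ⟨g, hg⟩ := exists_fInvHom_alphaUnitIn_eq p 𝔭 τ₀ f m hm
  refine ⟨⟨weilGerm (primeLevel p 𝔭) (toWeilGroup τ₀ (alphaUnitIn p 𝔭 τ₀ g)), weilGerm_toWeilGroup_mem_weilLimitIn p τ₀ _⟩, ?_⟩
  rw [fInvLim_mk]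
  exact hg

/-- **REMARK 5.2 (b): «`[π] ↦ f_π : X^*(P^K) → {f : Y → ℤ | f + ιf ∈ [K_{w₀} : ℚ_p]ℤ}` is an isomorphism»** — `X^*(P^K) = W^K(p^∞) =
weilLimitIn`, the target written multiplicatively. [cite: Milne1999, §5 p. 63 Remark 5.2 (b)] -/
def fInvLimEquiv [IsGalois ℚ K] : weilLimitIn K p τ₀ ≃* Multiplicative (admissibleFuns K p 𝔭) :=
  MulEquiv.ofBijective
    ({ toFun := fun x => Multiplicative.ofAdd ⟨(fInvLim p τ₀ x).toAdd, toAdd_fInvLim_mem_admissibleFuns p 𝔭 τ₀ x⟩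
       map_one' := by
         apply Multiplicative.toAdd.injective
         apply Subtype.ext
         change (fInvLim p τ₀ 1).toAdd = 0
         rw [map_one]; rfl
       map_mul' := fun x y => by
         apply Multiplicative.toAdd.injective
         apply Subtype.ext
         change (fInvLim p τ₀ (x * y)).toAdd = (fInvLim p τ₀ x).toAdd + (fInvLim p τ₀ y).toAdd
         rw [map_mul]; rfl } : weilLimitIn K p τ₀ →* Multiplicative (admissibleFuns K p 𝔭))
    (by
      constructor
      · intro x y h
        apply fInvLim_injective p τ₀
        apply Multiplicative.toAdd.injective
        have h' := congrArg (fun z : Multiplicative (admissibleFuns K p 𝔭) => ((Multiplicative.toAdd z : admissibleFuns K p 𝔭) :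
          primesOverSet p K → ℤ)) h
        exact h'
      · rintro f
        obtain ⟨x, hx⟩ := exists_fInvLim_eq p 𝔭 τ₀ (Multiplicative.toAdd f).2
        refine ⟨x, ?_⟩
        apply Multiplicative.toAdd.injective
        exact Subtype.ext hx)

/-- The isomorphism of Remark 5.2 (b) IS `[π] ↦ f_π`. [cite: Milne1999, §5 p. 63 Remark 5.2 (b)] -/
theorem coe_toAdd_fInvLimEquiv [IsGalois ℚ K] (x : weilLimitIn K p τ₀) :
    ((Multiplicative.toAdd (fInvLimEquiv p 𝔭 τ₀ x) : admissibleFuns K p 𝔭) : primesOverSet p K → ℤ) = (fInvLim p τ₀ x).toAdd :=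
  rfl

end Limit

/-! ### §5 REMARK 5.2 (a): `P^K` through its points and the injectivity of `α^K : P^K → S^K` -/

section Points

variable {K : Type} [Field K] [NumberField K] [IsCMField K] [IsGalois ℚ K]
variable (p : ℕ) [hp : Fact p.Prime] (𝔭 : Ideal (𝓞 K)) [h𝔭 : 𝔭.LiesOver (Ideal.span {(p : ℤ)})] [h𝔭P : 𝔭.IsPrime]
variable (τ₀ : K →ₐ[ℚ] cmNumbers)

/-- The action of `σ ∈ Γ = Gal(ℚ^{cm}/ℚ)` on `W^K(p^∞)` (restriction of g15-#3's action on `W(p^∞)`; `smul_mem_weilLimitIn`).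
[cite: Milne1999, §4 p. 61 L20–L21 («a Γ-submodule of W(p^∞)»)] -/
def weilLimitInAct (σ : cmNumbers ≃ₐ[ℚ] cmNumbers) : weilLimitIn K p τ₀ →* weilLimitIn K p τ₀ where
  toFun x := ⟨σ • (x : WeilLimit p), smul_mem_weilLimitIn p τ₀ σ x.2⟩
  map_one' := Subtype.ext (show σ • ((1 : weilLimitIn K p τ₀) : WeilLimit p) = 1 by
    rw [OneMemClass.coe_one, WeilLimit.smul_def, map_one])
  map_mul' x y := Subtype.ext (by
    change σ • ((x : WeilLimit p) * (y : WeilLimit p)) = σ • (x : WeilLimit p) * σ • (y : WeilLimit p)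
    exact smul_mul_weilLimit σ _ _)

omit h𝔭 h𝔭P in
/-- [cite: Milne1999, §4 p. 61 L20–L21] -/
@[simp] theorem coe_weilLimitInAct (σ : cmNumbers ≃ₐ[ℚ] cmNumbers) (x : weilLimitIn K p τ₀) :
    ((weilLimitInAct p τ₀ σ x : weilLimitIn K p τ₀) : WeilLimit p) = σ • (x : WeilLimit p) := rfl

/-- **`X^*(P^K) = W^K(p^∞)` AS A `Γ`-MODULE** («we define `P^K` to be the corresponding quotient of `P`»: the character module of `P^K`
is the `Γ`-submodule `W^K(p^∞)` of `X^*(P) = W(p^∞)`). [cite: Milne1999, §4 p. 61 L20–L21] -/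
def weilLimitInRep : Representation ℤ (cmNumbers ≃ₐ[ℚ] cmNumbers) (Additive (weilLimitIn K p τ₀)) where
  toFun σ := (MonoidHom.toAdditive (weilLimitInAct p τ₀ σ)).toIntLinearMap
  map_one' := LinearMap.ext fun x => by
    change Additive.ofMul (weilLimitInAct p τ₀ 1 (Additive.toMul x)) = x
    refine congrArg Additive.ofMul (Subtype.ext ?_)
    rw [coe_weilLimitInAct, WeilLimit.smul_def, weilLimAct_one]
    rfl
  map_mul' σ τ := LinearMap.ext fun x => by
    change Additive.ofMul (weilLimitInAct p τ₀ (σ * τ) (Additive.toMul x)) =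
      Additive.ofMul (weilLimitInAct p τ₀ σ (Additive.toMul (Additive.ofMul (weilLimitInAct p τ₀ τ (Additive.toMul x)))))
    refine congrArg Additive.ofMul (Subtype.ext ?_)
    rw [coe_weilLimitInAct, toMul_ofMul, coe_weilLimitInAct, coe_weilLimitInAct, WeilLimit.smul_def, WeilLimit.smul_def,
      WeilLimit.smul_def, weilLimAct_mul]

omit h𝔭 h𝔭P in
/-- [cite: Milne1999, §4 p. 61 L20–L21] -/
@[simp] theorem weilLimitInRep_apply (σ : cmNumbers ≃ₐ[ℚ] cmNumbers) (x : Additive (weilLimitIn K p τ₀)) :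
    weilLimitInRep p τ₀ σ x = Additive.ofMul (weilLimitInAct p τ₀ σ (Additive.toMul x)) := rfl

/-- The inclusion of character modules `X^*(P^K) = W^K(p^∞) ⊂ W(p^∞) = X^*(P)` (the quotient map `P → P^K` on characters).
[cite: Milne1999, §4 p. 61 L20–L21] -/
def weilLimitInSubtype : Additive (weilLimitIn K p τ₀) →ₗ[ℤ] Additive (WeilLimit p) :=
  (MonoidHom.toAdditive (weilLimitIn K p τ₀).subtype).toIntLinearMap

omit [IsGalois ℚ K] h𝔭 h𝔭P in
/-- [cite: Milne1999, §4 p. 61 L20–L21] -/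
@[simp] theorem weilLimitInSubtype_apply (x : Additive (weilLimitIn K p τ₀)) :
    weilLimitInSubtype p τ₀ x = Additive.ofMul ((Additive.toMul x : weilLimitIn K p τ₀) : WeilLimit p) := rfl

omit h𝔭 h𝔭P in
/-- The inclusion `W^K(p^∞) ⊂ W(p^∞)` is `Γ`-equivariant. [cite: Milne1999, §4 p. 61 L20–L21] -/
theorem weilLimitInSubtype_weilLimitInRep (σ : cmNumbers ≃ₐ[ℚ] cmNumbers) (x : Additive (weilLimitIn K p τ₀)) :
    weilLimitInSubtype p τ₀ (weilLimitInRep p τ₀ σ x) = weilLimRep p σ (weilLimitInSubtype p τ₀ x) := rfl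

variable (R : Type*) [CommRing R] [Algebra ℚ R]

/-- **`P^K(R) = Hom_Γ(W^K(p^∞), (ℚ^{cm} ⊗_ℚ R)ˣ)`, THE QUOTIENT `P^K` OF THE WEIL-NUMBER TORUS THROUGH ITS `R`-POINTS** («we define `P^K` to
be the corresponding quotient of `P`»; Q768's point functor `torusPoints` of the `Γ`-module `X^*(P^K) = W^K(p^∞)`, as g15-#3's
`weilTorusPoints p R = P(R)`). [cite: Milne1999, §4 p. 61 L20–L21] [cite: Milne2017, Ch. 12 Rem. 12.26] -/
abbrev weilTorusInPoints : Subgroup (Multiplicative (Additive (weilLimitIn K p τ₀)) →* (cmNumbers ⊗[ℚ] R)ˣ) :=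
  torusPoints ℚ cmNumbers R (weilLimitInRep p τ₀)

/-- **The quotient map `P(R) → P^K(R)`**: restriction of a point `f : W(p^∞) → (ℚ^{cm} ⊗ R)ˣ` to `W^K(p^∞)` (Q768 `torusPoints.comap` of
the inclusion of character modules). [cite: Milne1999, §4 p. 61 L20–L21] [cite: Milne2017, Ch. 12 Thm. 12.9 (a)] -/
def weilTorusToIn : weilTorusPoints p R →* weilTorusInPoints p τ₀ R :=
  torusPoints.comap ℚ cmNumbers R (weilLimitInRep p τ₀) (weilLimRep p) (weilLimitInSubtype p τ₀)
    (weilLimitInSubtype_weilLimitInRep p τ₀)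

/-- **`X^*(α^K) : X^*(S^K) → X^*(P^K) = W^K(p^∞)`, `g ↦ π(g) = [g(ϖ)]`** — g15-#5's `alphaCharOfPrime p 𝔭` with its target cut down to
`W^K(p^∞)` (g16-#2 `toMul_alphaCharOfPrime_mem_weilLimitIn`); `ℤ`-linear. [cite: Milne1999, §5 p. 63 L6–L9 («defines a homomorphism α^K : P^K → S^K»)] -/
def alphaCharIn : infinityTypes (cmNumbers ≃ₐ[ℚ] cmNumbers) (K →ₐ[ℚ] cmNumbers) cmNumbersConj →ₗ[ℤ]
    Additive (weilLimitIn K p τ₀) :=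
  AddMonoidHom.toIntLinearMap
    { toFun := fun g => Additive.ofMul ⟨Additive.toMul (alphaCharOfPrime p 𝔭 g), toMul_alphaCharOfPrime_mem_weilLimitIn p 𝔭 τ₀ g⟩
      map_zero' := by
        refine congrArg Additive.ofMul (Subtype.ext ?_)
        change Additive.toMul (alphaCharOfPrime p 𝔭 0) = 1
        rw [map_zero]; rfl
      map_add' := fun g g' => by
        refine congrArg Additive.ofMul (Subtype.ext ?_)
        change Additive.toMul (alphaCharOfPrime p 𝔭 (g + g')) =
          Additive.toMul (alphaCharOfPrime p 𝔭 g) * Additive.toMul (alphaCharOfPrime p 𝔭 g')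
        rw [map_add, toMul_add] }

/-- `alphaCharIn g = π(g)` in `W(p^∞)`. [cite: Milne1999, §5 p. 63 L6–L9] -/
@[simp] theorem coe_toMul_alphaCharIn (g : infinityTypes (cmNumbers ≃ₐ[ℚ] cmNumbers) (K →ₐ[ℚ] cmNumbers) cmNumbersConj) :
    ((Additive.toMul (alphaCharIn p 𝔭 τ₀ g) : weilLimitIn K p τ₀) : WeilLimit p) = Additive.toMul (alphaCharOfPrime p 𝔭 g) :=
  rfl

/-- `X^*(α^K)` followed by `W^K(p^∞) ⊂ W(p^∞)` is g15-#5's `alphaCharOfPrime`. [cite: Milne1999, §5 p. 63 L6–L9] -/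
theorem weilLimitInSubtype_alphaCharIn (g : infinityTypes (cmNumbers ≃ₐ[ℚ] cmNumbers) (K →ₐ[ℚ] cmNumbers) cmNumbersConj) :
    weilLimitInSubtype p τ₀ (alphaCharIn p 𝔭 τ₀ g) = alphaCharOfPrime p 𝔭 g := rfl

/-- **«It commutes with the action of `Γ`»**: `X^*(α^K)` is `Γ`-equivariant into `X^*(P^K)` (g15-#5 `alphaCharOfPrime_infinityTypesRep`).
[cite: Milne1999, §5 p. 63 L8–L9] -/
theorem alphaCharIn_infinityTypesRep (σ : cmNumbers ≃ₐ[ℚ] cmNumbers)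
    (g : infinityTypes (cmNumbers ≃ₐ[ℚ] cmNumbers) (K →ₐ[ℚ] cmNumbers) cmNumbersConj) :
    alphaCharIn p 𝔭 τ₀ (infinityTypesRep (cmNumbers ≃ₐ[ℚ] cmNumbers) (K →ₐ[ℚ] cmNumbers) cmNumbersConj σ g) =
      weilLimitInRep p τ₀ σ (alphaCharIn p 𝔭 τ₀ g) := by
  refine congrArg Additive.ofMul (Subtype.ext ?_)
  change Additive.toMul (alphaCharOfPrime p 𝔭 (infinityTypesRep _ _ cmNumbersConj σ g)) = σ • Additive.toMul (alphaCharOfPrime p 𝔭 g)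
  rw [alphaCharOfPrime_infinityTypesRep, weilLimRep_apply, toMul_ofMul]

/-- **`X^*(α^K) : X^*(S^K) → X^*(P^K) = W^K(p^∞)` IS SURJECTIVE** (Lemma 5.1, first map; the character form of Remark 5.2 (a)).
[cite: Milne1999, §5 p. 63 Lemma 5.1, Remark 5.2 (a)] -/
theorem alphaCharIn_surjective : Function.Surjective (alphaCharIn p 𝔭 τ₀) := by
  intro x
  obtain ⟨g, hg⟩ := (mem_weilLimitIn_iff_exists_alphaCharOfPrime_eq p 𝔭 τ₀ _).mp (Additive.toMul x).2
  exact ⟨g, congrArg Additive.ofMul (Subtype.ext hg)⟩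

/-- **`α^K : P^K(R) → S^K(R)`** for every commutative `ℚ`-algebra `R` («defines a homomorphism `α^K : P^K → S^K`»): Q768's `torusPoints.comap`
of the equivariant `X^*(α^K) = alphaCharIn`; g15-#5's `alphaPointsOfPrime : P(R) → S^K(R)` is its composite with `P(R) → P^K(R)`
(`alphaPointsIn_comp_weilTorusToIn`). [cite: Milne1999, §5 p. 63 L8–L9] -/
def alphaPointsIn : weilTorusInPoints p τ₀ R →* serrePoints ℚ cmNumbers K cmNumbersConj R :=
  torusPoints.comap ℚ cmNumbers R (infinityTypesRep (cmNumbers ≃ₐ[ℚ] cmNumbers) (K →ₐ[ℚ] cmNumbers) cmNumbersConj)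
    (weilLimitInRep p τ₀) (alphaCharIn p 𝔭 τ₀) (alphaCharIn_infinityTypesRep p 𝔭 τ₀)

/-- **`α^K` on `P` factors as `P(R) → P^K(R) → S^K(R)`**: g15-#5's `alphaPointsOfPrime p 𝔭 R = alphaPointsIn ∘ weilTorusToIn`.
[cite: Milne1999, §5 p. 63 L8–L9] -/
theorem alphaPointsIn_comp_weilTorusToIn :
    (alphaPointsIn p 𝔭 τ₀ R).comp (weilTorusToIn p τ₀ R) = alphaPointsOfPrime p 𝔭 R := rfl

/-- **REMARK 5.2 (a): «The lemma shows that the homomorphism `α^K : P^K → S^K` is injective»** — on `R`-points, for every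
commutative `ℚ`-algebra `R`: a point of `P^K` is a homomorphism on `X^*(P^K) = W^K(p^∞) = π(X^*(S^K))` (Lemma 5.1), so it is
determined by its composite with `X^*(α^K)`. [cite: Milne1999, §5 p. 63 Remark 5.2 (a)] -/
theorem alphaPointsIn_injective : Function.Injective (alphaPointsIn p 𝔭 τ₀ R) := by
  intro f₁ f₂ h
  apply Subtype.ext
  apply MonoidHom.ext
  intro x
  obtain ⟨g, hg⟩ := alphaCharIn_surjective p 𝔭 τ₀ (Multiplicative.toAdd x)
  have hx : x = Multiplicative.ofAdd (alphaCharIn p 𝔭 τ₀ g) := by rw [hg, ofAdd_toAdd]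
  have h1 := congrArg (fun F : serrePoints ℚ cmNumbers K cmNumbersConj R =>
    (F : Multiplicative (infinityTypes (cmNumbers ≃ₐ[ℚ] cmNumbers) (K →ₐ[ℚ] cmNumbers) cmNumbersConj) →* (cmNumbers ⊗[ℚ] R)ˣ)
      (Multiplicative.ofAdd g)) h
  rw [hx]
  exact h1

end Points

end CMNumbers

end Literature.NumberTheory.ComplexMultiplication

end
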